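import Literature.Analysis.FluidPDE.HardSpherePhaseSpaceProofs
import Literature.Analysis.FluidPDE.HardSphereEuclideanAlexander
import Literature.MathematicalPhysics.KineticTheory.HardSphereEuler
import HarnessLib

/-!
# The type of hard-sphere flows is inhabited (carrier witness for `HardSphereFlow`)

`Literature.Analysis.FluidPDE.HardSphereFlow G ε N` (`HardSphereDynamics`) is a *hypothesis
structure*: the almost-everywhere defined global flow of `N` hard spheres of diameter `ε` in
the geometry `G`, with its defining properties (Alexander 1975; Gallagher–Saint-Raymond–Texier
2013 Prop. 4.1.1; Cercignani–Illner–Pulvirenti 1994 Thm. 4.2.1, App. 4.A) as fields. Route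
items quantify over it (`∀ Φ : HardSphereFlow (Torus.geometry (Fin 3)) (hsDiameter σ N) (N+1),
…`), so their non-vacuity is the inhabitedness of this type. This file assembles, in one
importable place, the witnesses:

* **the physical region** — Alexander's theorem, *proved* in the tree:
  `HardSphereFlow_nonempty` (flat torus `T^d`, `0 < ε < 1/2`, every `N`; from
  `HardSphereFlow.nonempty_torus_holds`, `HardSphereAlexander`),
  `HardSphereFlow_nonempty_euclidean` (`ℝ^d`, `0 < ε`, every `N`; from
  `HardSphereFlow.nonempty_holds`, `HardSphereEuclideanAlexander`), and the fixed-reduced-density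
  scaling of the hydrodynamic-limit statements, `HardSphereFlow_nonempty_hsDiameter`
  (`T³`, diameter `hsDiameter σ N = σ (N+1)^{-1/3}`, `N + 1` spheres, `0 < σ < 1/2`);
  `Fact`-gated `Nonempty` instances;
* **degenerate parameters, explicit inhabitants** — `HardSphereFlow.zero` (no particle: the
  identity flow, for *every* geometry), `HardSphereFlow.ofVolumeEqZero` (Lebesgue-null
  hard-sphere domain, e.g. too many / too large spheres: the identity flow with empty good set),
  `HardSphereFlow.ofFreeFlight` (no two spheres can ever touch — `ε < 0`, or `N ≤ 1`: free
  flight on the whole phase space), specialised to `T^d` and `ℝ^d`;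
* **an empty corner** — `HardSphereFlow_isEmpty_euclidean_zero`: for diameter `ε = 0` on the
  line (`Fintype.card d = 1`) with `N ≥ 2` particles the type is EMPTY (at `ε = 0` a contact is a
  coincidence `x_i = x_j`, where the separation vector vanishes and no configuration is incoming,
  so a hard-sphere trajectory can have no collision at all and is free flight; but on the line a
  conull set of data runs into a coincidence). Hence the *uniform* statement
  `∀ params, Nonempty (HardSphereFlow params)` is false and inhabitedness is region-wise.

Not covered (neither inhabited nor empty is proved here): abstract geometries with `N ≥ 2`;
`T^d` with `N ≥ 2` and `ε = 0` (in dimension `≥ 2`) or `1/2 ≤ ε ≤ √d/2` (outside the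
minimal-image regime of `Torus.isHardSphereRegular_geometry`; no printed source treats this
contact convention).

## References

* R. K. Alexander, *The infinite hard sphere system*, PhD thesis, Berkeley (1975).
* I. Gallagher, L. Saint-Raymond, B. Texier, *From Newton to Boltzmann* (2013), Prop. 4.1.1.
* C. Cercignani, R. Illner, M. Pulvirenti, *The Mathematical Theory of Dilute Gases* (1994),
  Thm. 4.2.1, App. 4.A.
* H. Spohn, *Large Scale Dynamics of Interacting Particles* (1991), Part I Ch. 3 (the scaling
  `hsDiameter`).
-/

open MeasureTheory Set Filter Topology
open scoped ENNReal InnerProductSpace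

namespace Literature.Analysis.FluidPDE

noncomputable section

section Kinetic

variable {d : Type*} [Fintype d] {X : Type*} [MeasureSpace X] [TopologicalSpace X]

/-! ## Degenerate parameters: explicit inhabitants -/

namespace HardSphereFlow

/-- **No particle.** For `N = 0` the phase space `Fin 0 → X × ℝ^d` is a single point and the
identity map is a hard-sphere flow (every clause about pairs `i ≠ j` or particles `i : Fin 0`
is vacuous), for *every* geometry, diameter, measure and topology. [folklore] -/
def zero (G : Geometry d X) (ε : ℝ) : HardSphereFlow G ε 0 where
  flow _ z := z
  good := univ
  measurableSet_good := MeasurableSet.univ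
  good_subset z _ := mem_hardSphereDomain.2 fun i => i.elim0
  measure_compl_good := by rw [compl_univ, measure_empty]
  mapsTo_good _ := mapsTo_univ _ _
  flow_zero _ _ := rfl
  flow_add _ _ _ _ := rfl
  measurable_flow _ := measurable_id
  isTrajectory z _ :=
    { mem := fun _ => mem_hardSphereDomain.2 fun i => i.elim0
      locFinite := fun _ _ => finite_empty.subset (by rintro t ⟨⟨i, -⟩, -⟩; exact i.elim0)
      pos_continuous := fun i => i.elim0
      free := fun _ _ _ _ => funext fun i => i.elim0
      binary := fun _ i => i.elim0 }
  measurePreserving _ := MeasurePreserving.id _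

/-- **Null hard-sphere domain.** If the hard-sphere domain `D_ε^N` is Lebesgue-null (for
instance when it is empty: more, or larger, spheres than the position space can hold), the
Liouville measure vanishes and the identity map with *empty* good set is a hard-sphere flow.
[folklore] -/
def ofVolumeEqZero (G : Geometry d X) (ε : ℝ) (N : ℕ)
    (h : volume (hardSphereDomain G N ε) = 0) : HardSphereFlow G ε N where
  flow _ z := z
  good := ∅
  measurableSet_good := MeasurableSet.empty
  good_subset := empty_subset _
  measure_compl_good := by
    rw [compl_empty, liouville_eq, Measure.restrict_apply MeasurableSet.univ, univ_inter, h]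
  mapsTo_good _ := mapsTo_empty _ _
  flow_zero _ _ := rfl
  flow_add _ _ _ _ := rfl
  measurable_flow _ := measurable_id
  isTrajectory _ hz := ((mem_empty_iff_false _).1 hz).elim
  measurePreserving _ := MeasurePreserving.id _

end HardSphereFlow

omit [MeasureSpace X] in
/-- A free-flight orbit along which no pair of spheres is ever in contact is a hard-sphere
trajectory: its set of collision times is empty, so the `free` clause is the group law of free
flight and the `binary` clause is vacuous (GST 2013 Def. 4.1.2 with no collision). [folklore] -/
theorem isHardSphereTrajectory_freeFlight {G : Geometry d X} {ε : ℝ} {N : ℕ} (z : Config N d X)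
    (hmem : ∀ t, freeFlight G t z ∈ hardSphereDomain G N ε)
    (hC : ∀ t (i j : Fin N), i ≠ j → freeFlight G t z ∉ contactSet G N ε i j)
    (hcont : ∀ i, Continuous fun t : ℝ => G.translate (z i).1 (t • (z i).2)) :
    IsHardSphereTrajectory G ε N fun t => freeFlight G t z where
  mem := hmem
  locFinite _ _ :=
    finite_empty.subset (by rintro t ⟨⟨i, j, hij, ht⟩, -⟩; exact hC t i j hij ht)
  pos_continuous i := hcont i
  free s t _ _ := by rw [← freeFlight_add, sub_add_cancel]
  binary t i j hij ht := (hC t i j hij ht).elim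

namespace HardSphereFlow

/-- **Free flight as a hard-sphere flow.** If every configuration has all its pairs at
separation `> ε` (so `D_ε^N` is the whole phase space and no contact configuration exists —
the cases `ε < 0` and `N ≤ 1`), and free flight in the geometry `G` is measurable, preserves
the volume of the phase space and is continuous in time, then free flight on the whole phase
space is a hard-sphere flow (CIP 1994 §4.2: between collisions the dynamics is free
transport, which preserves `dx dv`). [cite: CIP1994, §4.2] -/
def ofFreeFlight (G : Geometry d X) (ε : ℝ) (N : ℕ)
    (hsep : ∀ (z : Config N d X) (i j : Fin N), i ≠ j → ε < ‖G.sepVec (z i).1 (z j).1‖)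
    (hmeas : ∀ t, Measurable (freeFlight (N := N) G t))
    (hvol : ∀ t, MeasurePreserving (freeFlight (N := N) G t) volume volume)
    (hcont : ∀ (x : X) (v : EuclideanSpace ℝ d),
      Continuous fun t : ℝ => G.translate x (t • v)) :
    HardSphereFlow G ε N :=
  have hD : hardSphereDomain G N ε = univ :=
    eq_univ_of_forall fun z => mem_hardSphereDomain.2 fun i j hij => (hsep z i j hij).le
  have hC : ∀ (z : Config N d X) (i j : Fin N), i ≠ j → z ∉ contactSet G N ε i j :=
    fun z i j hij hz => (hsep z i j hij).ne' (mem_contactSet.1 hz).2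
  { flow := fun t => freeFlight G t
    good := univ
    measurableSet_good := MeasurableSet.univ
    good_subset := by rw [hD]
    measure_compl_good := by rw [compl_univ, measure_empty]
    mapsTo_good := fun _ => mapsTo_univ _ _
    flow_zero := fun z _ => freeFlight_zero G z
    flow_add := fun s t z _ => freeFlight_add G s t z
    measurable_flow := hmeas
    isTrajectory := fun z _ =>
      isHardSphereTrajectory_freeFlight z (fun t => hD ▸ mem_univ _)
        (fun t i j hij => hC _ i j hij) fun i => hcont _ _
    measurePreserving := fun t => by
      rw [liouville_eq, hD, Measure.restrict_univ]
      exact hvol t }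

end HardSphereFlow

end Kinetic

/-! ## Free flight on the torus and on the whole space -/

section Concrete

variable {d : Type*} [Fintype d]

/-- On the flat torus, free flight is a hard-sphere flow as soon as no two spheres can touch
(`hsep`; used below for `ε < 0` and for `N ≤ 1`): translations of `T^d` are measurable,
continuous and preserve Haar measure (`measurePreserving_freeFlight_of_translate`).
[cite: CIP1994, §4.2] -/
def HardSphereFlow.torusFreeFlight (ε : ℝ) (N : ℕ)
    (hsep : ∀ (z : Config N d (UnitAddTorus d)) (i j : Fin N), i ≠ j →
      ε < ‖(Torus.geometry d).sepVec (z i).1 (z j).1‖) :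
    HardSphereFlow (Torus.geometry d) ε N :=
  HardSphereFlow.ofFreeFlight (Torus.geometry d) ε N hsep
    (fun t => Torus.isMeasurable_geometry.measurable_freeFlight t)
    (fun t => measurePreserving_freeFlight_of_translate
      Torus.isMeasurable_geometry.measurable_translate
      (fun v => (measurePreserving_add_right volume (FunctionSpaces.Torus.proj v)).map_eq) t)
    (fun x v => by
      change Continuous fun t : ℝ => x + FunctionSpaces.Torus.proj (t • v)
      exact continuous_const.add
        (FunctionSpaces.Torus.continuous_proj.comp (continuous_id.smul continuous_const)))

/-- On the whole space `ℝ^d`, free flight is a hard-sphere flow as soon as no two spheres can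
touch (`hsep`): translations of `ℝ^d` are measurable, continuous and preserve Lebesgue measure
(`measurePreserving_freeFlight_holds`). [cite: CIP1994, §4.2] -/
def HardSphereFlow.euclideanFreeFlight (ε : ℝ) (N : ℕ)
    (hsep : ∀ (z : Config N d (EuclideanSpace ℝ d)) (i j : Fin N), i ≠ j →
      ε < ‖(Euclidean.geometry d).sepVec (z i).1 (z j).1‖) :
    HardSphereFlow (Euclidean.geometry d) ε N :=
  HardSphereFlow.ofFreeFlight (Euclidean.geometry d) ε N hsep (fun t => measurable_freeFlight t)
    (fun t => measurePreserving_freeFlight_holds t)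
    (fun x v => by
      change Continuous fun t : ℝ => x + t • v
      exact continuous_const.add (continuous_id.smul continuous_const))

/-- **Negative diameter, torus.** For `ε < 0` there is no contact configuration at all and free
flight on `(T^d × ℝ^d)^N` is a hard-sphere flow, for every `N`. [folklore] -/
theorem HardSphereFlow_nonempty_torus_of_neg {ε : ℝ} (hε : ε < 0) (N : ℕ) :
    Nonempty (HardSphereFlow (Torus.geometry d) ε N) :=
  ⟨HardSphereFlow.torusFreeFlight ε N fun _ _ _ _ => hε.trans_le (norm_nonneg _)⟩

/-- **Negative diameter, whole space.** For `ε < 0` free flight on `(ℝ^d × ℝ^d)^N` is a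
hard-sphere flow, for every `N`. [folklore] -/
theorem HardSphereFlow_nonempty_euclidean_of_neg {ε : ℝ} (hε : ε < 0) (N : ℕ) :
    Nonempty (HardSphereFlow (Euclidean.geometry d) ε N) :=
  ⟨HardSphereFlow.euclideanFreeFlight ε N fun _ _ _ _ => hε.trans_le (norm_nonneg _)⟩

/-- **At most one sphere, torus.** For `N ≤ 1` there is no pair of particles and free flight is
a hard-sphere flow on `T^d`, for every diameter. [folklore] -/
theorem HardSphereFlow_nonempty_torus_of_le_one (ε : ℝ) {N : ℕ} (hN : N ≤ 1) :
    Nonempty (HardSphereFlow (Torus.geometry d) ε N) :=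
  ⟨HardSphereFlow.torusFreeFlight ε N fun _ i j hij => absurd (Fin.ext (by omega)) hij⟩

/-- **At most one sphere, whole space.** For `N ≤ 1` free flight is a hard-sphere flow on `ℝ^d`,
for every diameter. [folklore] -/
theorem HardSphereFlow_nonempty_euclidean_of_le_one (ε : ℝ) {N : ℕ} (hN : N ≤ 1) :
    Nonempty (HardSphereFlow (Euclidean.geometry d) ε N) :=
  ⟨HardSphereFlow.euclideanFreeFlight ε N fun _ i j hij => absurd (Fin.ext (by omega)) hij⟩

end Concrete

/-! ## The physical region: Alexander's theorem (proved in the tree) -/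

section Alexander

variable {d : Type*} [Fintype d] {X : Type*} [MeasureSpace X] [TopologicalSpace X]

/-- **`HardSphereFlow G ε 0` is inhabited** for every geometry (the identity flow
`HardSphereFlow.zero`). [folklore] -/
theorem HardSphereFlow_nonempty_zero (G : Geometry d X) (ε : ℝ) :
    Nonempty (HardSphereFlow G ε 0) :=
  ⟨HardSphereFlow.zero G ε⟩

/-- Unconditional instance: no particle. [folklore] -/
instance HardSphereFlow.instNonemptyZero (G : Geometry d X) (ε : ℝ) :
    Nonempty (HardSphereFlow G ε 0) := HardSphereFlow_nonempty_zero G ε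

/-- **`HardSphereFlow G ε N` is inhabited whenever the hard-sphere domain is Lebesgue-null**
(`HardSphereFlow.ofVolumeEqZero`). [folklore] -/
theorem HardSphereFlow_nonempty_of_volume_eq_zero (G : Geometry d X) {ε : ℝ} {N : ℕ}
    (h : volume (hardSphereDomain G N ε) = 0) : Nonempty (HardSphereFlow G ε N) :=
  ⟨HardSphereFlow.ofVolumeEqZero G ε N h⟩

/-- **Alexander's theorem on the flat torus** (the carrier witness on the physical region):
for `0 < ε < 1/2` and every `N`, the type `HardSphereFlow (Torus.geometry d) ε N` of global
hard-sphere flows of `N` spheres of diameter `ε` on `T^d` is inhabited — the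
collision-by-collision flow is well defined outside a Liouville-null set, is a measurable group
of hard-sphere trajectories and preserves the Liouville measure (Alexander 1975; GST 2013
Prop. 4.1.1; CIP 1994 Thm. 4.2.1, App. 4.A). This is the tree's theorem
`HardSphereFlow.nonempty_torus_holds` (`HardSphereAlexander`).
[cite: Alexander1975] [cite: GST2013, Prop. 4.1.1 p. 19] -/
theorem HardSphereFlow_nonempty {ε : ℝ} (hε : 0 < ε) (hε' : ε < 2⁻¹) (N : ℕ) :
    Nonempty (HardSphereFlow (Torus.geometry d) ε N) :=
  HardSphereFlow.nonempty_torus_holds hε hε' N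

/-- **Alexander's theorem in `ℝ^d`**: for `0 < ε` and every `N` the type
`HardSphereFlow (Euclidean.geometry d) ε N` is inhabited (Alexander 1975; GST 2013 Prop. 4.1.1;
CIP 1994 App. 4.A); the tree's theorem `HardSphereFlow.nonempty_holds`
(`HardSphereEuclideanAlexander`). [cite: Alexander1975] [cite: GST2013, Prop. 4.1.1 p. 19] -/
theorem HardSphereFlow_nonempty_euclidean {ε : ℝ} (hε : 0 < ε) (N : ℕ) :
    Nonempty (HardSphereFlow (Euclidean.geometry d) ε N) :=
  HardSphereFlow.nonempty_holds hε N

/-- `Fact`-gated instance form of Alexander's theorem on `T^d`. [cite: Alexander1975] -/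
instance HardSphereFlow.instNonemptyTorus {ε : ℝ} [hε : Fact (0 < ε)]
    [hε' : Fact (ε < 2⁻¹)] (N : ℕ) : Nonempty (HardSphereFlow (Torus.geometry d) ε N) :=
  HardSphereFlow_nonempty hε.out hε'.out N

/-- `Fact`-gated instance form of Alexander's theorem in `ℝ^d`. [cite: Alexander1975] -/
instance HardSphereFlow.instNonemptyEuclidean {ε : ℝ} [hε : Fact (0 < ε)] (N : ℕ) :
    Nonempty (HardSphereFlow (Euclidean.geometry d) ε N) :=
  HardSphereFlow_nonempty_euclidean hε.out N

/-- **The hydrodynamic-limit carrier is inhabited.** At fixed reduced density `0 < σ < 1/2`,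
for every `N` the type of hard-sphere flows of `N + 1` spheres of diameter
`hsDiameter σ N = σ (N+1)^{-1/3}` on `T³` is inhabited: `0 < hsDiameter σ N ≤ σ < 1/2`
(`hsDiameter_pos`, `hsDiameter_le`) is in the range of Alexander's theorem.
[cite: Alexander1975] -/
theorem HardSphereFlow_nonempty_hsDiameter {σ : ℝ} (hσ : 0 < σ) (hσ' : σ < 2⁻¹)
    (N : ℕ) : Nonempty (HardSphereFlow (Torus.geometry (Fin 3))
      (Literature.MathematicalPhysics.KineticTheory.hsDiameter σ N) (N + 1)) :=
  HardSphereFlow_nonempty (Literature.MathematicalPhysics.KineticTheory.hsDiameter_pos hσ N)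
    ((Literature.MathematicalPhysics.KineticTheory.hsDiameter_le hσ.le N).trans_lt hσ') (N + 1)

/-- Family form over the particle number, as the hydrodynamic-limit statements quantify it
(`∀ Φ : (N : ℕ) → HardSphereFlow (Torus.geometry (Fin 3)) (hsDiameter σ N) (N + 1), …`):
the dependent function type is inhabited for `0 < σ < 1/2`. [cite: Alexander1975] -/
theorem HardSphereFlow_nonempty_hsDiameter_pi {σ : ℝ} (hσ : 0 < σ) (hσ' : σ < 2⁻¹) :
    Nonempty ((N : ℕ) → HardSphereFlow (Torus.geometry (Fin 3))
      (Literature.MathematicalPhysics.KineticTheory.hsDiameter σ N) (N + 1)) :=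
  ⟨fun N => (HardSphereFlow_nonempty_hsDiameter hσ hσ' N).some⟩

end Alexander

/-! ## An empty corner: diameter `0` on the line -/

section IsEmpty

variable {d : Type*} [Fintype d] {X : Type*} [TopologicalSpace X] [T2Space X]

/-- **At diameter `0` there is no collision.** Over a Hausdorff position space a hard-sphere
trajectory of spheres of diameter `ε = 0` has no collision time: a contact is a coincidence
(`‖x_i - x_j‖ = 0`), positions do not jump, so the left limit at a contact time has the same
vanishing separation vector and cannot be incoming (`⟪0, v_i - v_j⟫ < 0` is false), against the
`binary` clause. [folklore] -/
theorem IsHardSphereTrajectory.collisionTimes_eq_empty_of_zero {G : Geometry d X} {N : ℕ}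
    {γ : ℝ → Config N d X} (h : IsHardSphereTrajectory G 0 N γ) :
    collisionTimes G 0 γ = ∅ := by
  refine eq_empty_of_forall_notMem fun t ht => ?_
  obtain ⟨i, j, hij, hc⟩ := ht
  obtain ⟨-, zl, hzl, hin, -⟩ := h.binary t i j hij hc
  have hpos : ∀ k, (zl k).1 = (γ t k).1 := fun k => by
    have hev : Continuous fun z : Config N d X => (z k).1 := by fun_prop
    exact tendsto_nhds_unique ((hev.tendsto zl).comp hzl)
      (((h.pos_continuous k).tendsto t).mono_left nhdsWithin_le_nhds)
  have h0 : G.sepVec (zl i).1 (zl j).1 = 0 := by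
    rw [hpos i, hpos j, ← norm_eq_zero]
    exact (mem_contactSet.1 hc).2
  simp [IsIncoming, h0] at hin

/-- Consequently, at diameter `0` a hard-sphere trajectory over a Hausdorff position space is
free flight from its time-`0` value at *all* times (forward by the `free` clause, backward by
inverting free flight). [folklore] -/
theorem IsHardSphereTrajectory.eq_freeFlight_of_zero {G : Geometry d X} {N : ℕ}
    {γ : ℝ → Config N d X} (h : IsHardSphereTrajectory G 0 N γ) (t : ℝ) :
    γ t = freeFlight G t (γ 0) := by
  have hfree : ∀ s u, s ≤ u → γ u = freeFlight G (u - s) (γ s) := fun s u hsu =>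
    h.free s u hsu fun τ _ hτ => by simp [h.collisionTimes_eq_empty_of_zero] at hτ
  rcases le_total 0 t with ht | ht
  · simpa using hfree 0 t ht
  · rw [hfree t 0 ht, ← freeFlight_add, zero_sub, add_neg_cancel, freeFlight_zero]

/-- **An empty corner of the parameter space.** On the line (`Fintype.card d = 1`), at diameter
`ε = 0`, with `N ≥ 2` particles, the type `HardSphereFlow (Euclidean.geometry d) 0 N` is EMPTY:
by `IsHardSphereTrajectory.eq_freeFlight_of_zero` every good orbit would be collision-free free
flight, but the good set is conull, hence meets the open set of data in which particles `0` and
`1` have different velocities, and on the line two such particles coincide — are in contact at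
diameter `0` — at the time `t = -(x₀ - x₁)/(v₀ - v₁)`. (The same happens on the circle
`T¹`.) So the uniform statement `∀ G ε N, Nonempty (HardSphereFlow G ε N)` is false; every
statement quantifying over this corner is vacuous. [folklore] -/
theorem HardSphereFlow_isEmpty_euclidean_zero (hd : Fintype.card d = 1) {N : ℕ} (hN : 2 ≤ N) :
    IsEmpty (HardSphereFlow (Euclidean.geometry d) 0 N) := by
  obtain ⟨k₀, hk₀⟩ := Fintype.card_eq_one_iff.1 hd
  refine ⟨fun Φ => ?_⟩
  set i : Fin N := ⟨0, by omega⟩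
  set j : Fin N := ⟨1, by omega⟩
  have hij : i ≠ j := fun h => by simpa [i, j] using congrArg Fin.val h
  -- the open set of data in which particles `i` and `j` have different velocities
  set A : Set (Config N d (EuclideanSpace ℝ d)) := {z | (z i).2 ≠ (z j).2} with hA_def
  have hA : IsOpen A := isOpen_ne_fun (by fun_prop) (by fun_prop)
  have hAne : A.Nonempty := by
    refine ⟨fun k => (0, if k = i then WithLp.toLp 2 (fun _ => (1 : ℝ)) else 0), ?_⟩
    have h1 : (WithLp.toLp 2 (fun _ : d => (1 : ℝ)) : EuclideanSpace ℝ d) ≠ 0 := fun h0 => by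
      simpa using congrArg (fun v : EuclideanSpace ℝ d => v k₀) h0
    simpa [A, hij.symm] using h1
  haveI := Euclidean.isAddHaarMeasure_volume_config (N := N) (d := d)
  have hApos : 0 < volume A := hA.measure_pos volume hAne
  -- at diameter `0` the hard-sphere domain is everything, so the good set is `volume`-conull
  have hD : hardSphereDomain (Euclidean.geometry d) N 0 = univ :=
    eq_univ_of_forall fun z => mem_hardSphereDomain.2 fun _ _ _ => norm_nonneg _
  have hgood : volume Φ.goodᶜ = 0 := by
    simpa [liouville_eq, hD] using Φ.measure_compl_good
  obtain ⟨z, hzg, hzA⟩ : (Φ.good ∩ A).Nonempty := by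
    by_contra hc
    exact hApos.ne' (measure_mono_null (fun z hz hzg => hc ⟨z, hzg, hz⟩) hgood)
  have hzA' : (z i).2 ≠ (z j).2 := hzA
  have hb : (z i).2 k₀ - (z j).2 k₀ ≠ 0 := fun h0 =>
    hzA' (by ext k; rw [hk₀ k]; exact sub_eq_zero.1 h0)
  -- the coincidence time of particles `i` and `j` along free flight
  obtain ⟨t₀, ht₀⟩ : ∃ t₀ : ℝ,
      (z i).1 k₀ - (z j).1 k₀ + t₀ * ((z i).2 k₀ - (z j).2 k₀) = 0 :=
    ⟨-((z i).1 k₀ - (z j).1 k₀) / ((z i).2 k₀ - (z j).2 k₀), by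
      rw [div_mul_cancel₀ _ hb, add_neg_cancel]⟩
  have htraj := Φ.isTrajectory z hzg
  have hflow : Φ.flow t₀ z = freeFlight (Euclidean.geometry d) t₀ z := by
    simpa [Φ.flow_zero z hzg] using htraj.eq_freeFlight_of_zero t₀
  have hsep0 : (Euclidean.geometry d).sepVec (freeFlight (Euclidean.geometry d) t₀ z i).1
      (freeFlight (Euclidean.geometry d) t₀ z j).1 = 0 := by
    ext k
    rw [hk₀ k]
    simp only [freeFlight_apply, Euclidean.geometry_translate, Euclidean.geometry_sepVec,
      PiLp.sub_apply, PiLp.add_apply, PiLp.smul_apply, smul_eq_mul, PiLp.zero_apply]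
    linear_combination ht₀
  have hmem : t₀ ∈ collisionTimes (Euclidean.geometry d) 0 fun t => Φ.flow t z := by
    refine ⟨i, j, hij, ?_⟩
    change Φ.flow t₀ z ∈ contactSet (Euclidean.geometry d) N 0 i j
    rw [hflow]
    exact mem_contactSet.2 ⟨hD ▸ mem_univ _, by rw [hsep0, norm_zero]⟩
  simp [htraj.collisionTimes_eq_empty_of_zero] at hmem

end IsEmpty

end

end Literature.Analysis.FluidPDE
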